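import Summits.ValiantsHypothesis.ValiantsHypothesis.Theorems.DefinabilityGapSingularSplitting
import HarnessLib

/-!
# DefinabilityGap — the skeleton flag: `(w − 1)`-support witnesses for nonsingular chains (kernel)

Helper under **the leaf the read-once route asks for**, stmt-23704 `KIPlantedHittingRO`
(*leaf asks width `q^b` and degree `q^b`, arbitrary read-once order*), rev-10 route
`Theses/DefinabilityGap.lean` (DRAFT).  This file is the ORDER-FREE, GENERATOR-FREE half of
the lineage-5 g34 node «nonsingular chains of EVERY constant width»; its companion
`DefinabilityGapFreeAxes.lean` supplies the `G_m`-side instrument and the hitting theorem.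
**0 S-currency · closes NO item · the leaf 23704, the K1 / F4 / W10 tags, rev-10 `closes` and
`VP ≠ VNP` are untouched.**

## What is proved (w : ℕ arbitrary)

* §1 THE SKELETON FLAG (pure linear algebra over `ℂ`).  Data: skeleton matrices
  `B_1, …, B_N ∈ GL_w(ℂ)` (`IsUnit`), free links `P_i : ℂ → M_w(ℂ)`, a vector `v`.  A
  *selection* `a : Fin N → Option ℂ` picks, at every position, either the skeleton matrix
  (`none`) or a free value (`some s`); `Γ_s` (`gam … s`) is the span of the selected vectors
  `(∏ selected) v` with at most `s` free positions.  `exists_flag`: the full span `Γ_N` is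
  already `Γ_j` for some `j` with `j + 1 ≤ dim Γ_N` — every free position either leaves the
  image of the flag unchanged or raises its dimension, and the dimension is at most `w`.  Hence
  (`dotProduct_selProd_eq_zero`) a covector killing all selections with `≤ w − 1` free positions
  kills every selection.
* §2 CHAINS.  `chainPoly π P u v = uᵀ · P_1(z_{π 1}) ⋯ P_N(z_{π N}) · v` for univariate
  polynomial matrices `P_i ∈ M_w(ℂ[X])` read in the injective order `π : Fin N → σ`
  (`eval_chainPoly`).  ★ `chainPoly_eq_zero_of_restrict`: if `t ∈ ℂ` makes every link
  nonsingular (`det P_i(t) ≠ 0`) and every restriction of the chain to at most `w − 1` free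
  variables (the others frozen at `t`) vanishes, the chain polynomial is `0`.

## Honest label

K4′ HONESTY (CALL 2490, verbatim): «ELEMENTARY · VARIANT: the (w−1)-support witness is CLASSICAL in
kind (weighted-automata / ROABP low-support lineage, cites); NEW only in G_m's currency = the
multi-block free axes; det ≠ 0 sharp in kind; 2w ≤ m + 1 = the free-block budget, NOT claimed
optimal; singular links of width ≥ 3 and the leaf regime w = q^b ≫ m NOT claimed; leaf asks width
q^b; 0 S-currency; closes NO item; K1 / F4 / W10 tags untouched».
In detail: ELEMENTARY · VARIANT of the classical small-support / low-dimensional-shift witnesses for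
read-once products (Schützenberger 1961 length bound for weighted automata; the ROABP
shift-and-concentrate arguments [SahaSaptharishiSaxena2009]-lineage, Agrawal–Saha–Saxena 2013,
Forbes–Saptharishi–Shpilka 2014) — CLASSICAL content, new only in being typed for the
`G_m`/`kiPer` currency of this route.  It is NOT a statement about singular links: a
rank-dropping link `P_i(t)` breaks `map_skel_le`'s injectivity count and the jump bound
`w − 1`; the hypothesis is sharp in kind: the width-2 chain
`(z₁ − z₂)(z₃ − z₄) = e₀ᵀ·[[1,z₁],[0,0]]·[[−z₂,0],[1,0]]·[[1,z₃],[0,0]]·[[−z₄,0],[1,0]]·e₀` with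
SINGULAR links is nonzero although every restriction to `≤ 1 = w − 1` free variable (the others
at any `t`) vanishes.  That residual (singular links, `w ≥ 3`) is recorded, NOT claimed.
0 S-currency; closes NO item. [rung nonsingular constant width under leaf 23704 · 0 S-currency ·
closes NO item]

## Worked instance (non-vacuity of the hypothesis class)

`w = 3`, links `U(z) = [[1,z,0],[0,1,z],[0,0,1]]` (det `1`), `u = e₀`, `v = e₂`:
`chainPoly = e₂(z_{π 1}, …, z_{π N})`, whose Nisan cut-rank is `3` at every cut with two
variables on each side (`N ≥ 4`) — a width-3-ESSENTIAL nonsingular chain, outside the reach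
of the width-2 files `…TranslatedSkeleton` / `…SingularSplitting`; §2 says it is determined by
its restrictions to `2` free variables at any `t`.
-/

noncomputable section

open MvPolynomial

open scoped Polynomial

set_option linter.dupNamespace false

namespace Summit.ValiantsHypothesis.ValiantsHypothesis.Theorems.DefinabilityGapSkeletonFlag

variable {w N : ℕ}

/-! ## 1. The skeleton flag -/

/-- The selected product: at position `i` the skeleton matrix `B i` (`a i = none`) or the free
link value `P i s` (`a i = some s`), multiplied in order. [this file, data] -/
def selProd (B : Fin N → Matrix (Fin w) (Fin w) ℂ) (P : Fin N → ℂ → Matrix (Fin w) (Fin w) ℂ)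
    (a : Fin N → Option ℂ) : Matrix (Fin w) (Fin w) ℂ :=
  (List.ofFn fun i => (a i).elim (B i) (P i)).prod

/-- The number of free positions of a selection. [this file, data] -/
def freeCount (a : Fin N → Option ℂ) : ℕ :=
  (Finset.univ.filter fun i => (a i).isSome).card

/-- The flag piece `Γ_s`: the span of the selected vectors with at most `s` free positions.
[this file, data] -/
def gam (B : Fin N → Matrix (Fin w) (Fin w) ℂ) (P : Fin N → ℂ → Matrix (Fin w) (Fin w) ℂ)
    (v : Fin w → ℂ) (s : ℕ) : Submodule ℂ (Fin w → ℂ) :=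
  Submodule.span ℂ {x | ∃ a : Fin N → Option ℂ, freeCount a ≤ s ∧ (selProd B P a).mulVec v = x}

/-- At most `N` positions are free. -/
theorem freeCount_le (a : Fin N → Option ℂ) : freeCount a ≤ N :=
  (Finset.card_filter_le _ _).trans (by rw [Finset.card_univ, Fintype.card_fin])

/-- The free count splits off the first position. -/
theorem freeCount_succ (a : Fin (N + 1) → Option ℂ) :
    freeCount a = (if (a 0).isSome then 1 else 0) + freeCount (Fin.tail a) := by
  rw [freeCount, freeCount, Finset.card_filter, Finset.card_filter, Fin.sum_univ_succ]
  rfl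

/-- The selected product splits off the first position. -/
theorem selProd_succ (B : Fin (N + 1) → Matrix (Fin w) (Fin w) ℂ)
    (P : Fin (N + 1) → ℂ → Matrix (Fin w) (Fin w) ℂ) (a : Fin (N + 1) → Option ℂ) :
    selProd B P a = (a 0).elim (B 0) (P 0) * selProd (Fin.tail B) (Fin.tail P) (Fin.tail a) := by
  rw [selProd, List.ofFn_succ, List.prod_cons]
  rfl

/-- A selected vector with at most `s` free positions lies in `Γ_s`. -/
theorem mem_gam {B : Fin N → Matrix (Fin w) (Fin w) ℂ} {P : Fin N → ℂ → Matrix (Fin w) (Fin w) ℂ}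
    {v : Fin w → ℂ} {s : ℕ} {a : Fin N → Option ℂ} (ha : freeCount a ≤ s) :
    (selProd B P a).mulVec v ∈ gam B P v s :=
  Submodule.subset_span ⟨a, ha, rfl⟩

/-- The flag pieces increase with `s`. -/
theorem gam_mono (B : Fin N → Matrix (Fin w) (Fin w) ℂ) (P : Fin N → ℂ → Matrix (Fin w) (Fin w) ℂ)
    (v : Fin w → ℂ) {s s' : ℕ} (h : s ≤ s') : gam B P v s ≤ gam B P v s' :=
  Submodule.span_mono fun _ ⟨a, ha, hx⟩ => ⟨a, ha.trans h, hx⟩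

/-- Prepending the skeleton matrix keeps the free count. -/
theorem map_skel_le (B : Fin (N + 1) → Matrix (Fin w) (Fin w) ℂ)
    (P : Fin (N + 1) → ℂ → Matrix (Fin w) (Fin w) ℂ) (v : Fin w → ℂ) (s : ℕ) :
    (gam (Fin.tail B) (Fin.tail P) v s).map (B 0).mulVecLin ≤ gam B P v s := by
  refine (Submodule.map_span_le _ _ _).2 ?_
  rintro x ⟨a, ha, rfl⟩
  have h1 : selProd B P (Fin.cons none a) = B 0 * selProd (Fin.tail B) (Fin.tail P) a := by
    simp only [selProd_succ, Fin.cons_zero, Fin.tail_cons, Option.elim]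
  rw [Matrix.mulVecLin_apply, Matrix.mulVec_mulVec, ← h1]
  refine mem_gam ?_
  rw [freeCount_succ, Fin.cons_zero, Fin.tail_cons, Option.isSome_none, if_neg Bool.false_ne_true]
  omega

/-- Prepending a free value raises the free count by one. -/
theorem map_free_le (B : Fin (N + 1) → Matrix (Fin w) (Fin w) ℂ)
    (P : Fin (N + 1) → ℂ → Matrix (Fin w) (Fin w) ℂ) (v : Fin w → ℂ) (x : ℂ) (s : ℕ) :
    (gam (Fin.tail B) (Fin.tail P) v s).map (P 0 x).mulVecLin ≤ gam B P v (s + 1) := by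
  refine (Submodule.map_span_le _ _ _).2 ?_
  rintro y ⟨a, ha, rfl⟩
  have h1 : selProd B P (Fin.cons (some x) a) = P 0 x * selProd (Fin.tail B) (Fin.tail P) a := by
    simp only [selProd_succ, Fin.cons_zero, Fin.tail_cons, Option.elim]
  rw [Matrix.mulVecLin_apply, Matrix.mulVec_mulVec, ← h1]
  refine mem_gam ?_
  rw [freeCount_succ, Fin.cons_zero, Fin.tail_cons, Option.isSome_some, if_pos rfl]
  omega

/-- The full span splits by the first position. -/
theorem gam_succ_le (B : Fin (N + 1) → Matrix (Fin w) (Fin w) ℂ)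
    (P : Fin (N + 1) → ℂ → Matrix (Fin w) (Fin w) ℂ) (v : Fin w → ℂ) :
    gam B P v (N + 1) ≤ (gam (Fin.tail B) (Fin.tail P) v N).map (B 0).mulVecLin ⊔
      ⨆ x : ℂ, (gam (Fin.tail B) (Fin.tail P) v N).map (P 0 x).mulVecLin := by
  refine Submodule.span_le.2 ?_
  rintro y ⟨a, -, rfl⟩
  have ht : (selProd (Fin.tail B) (Fin.tail P) (Fin.tail a)).mulVec v ∈
      gam (Fin.tail B) (Fin.tail P) v N := mem_gam (freeCount_le _)
  rw [SetLike.mem_coe, selProd_succ, ← Matrix.mulVec_mulVec]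
  cases h0 : a 0 with
  | none =>
    have h := Submodule.mem_map_of_mem (f := (B 0).mulVecLin) ht
    rw [Matrix.mulVecLin_apply] at h
    show (B 0).mulVec _ ∈ _
    exact Submodule.mem_sup_left h
  | some x =>
    have h := Submodule.mem_map_of_mem (f := (P 0 x).mulVecLin) ht
    rw [Matrix.mulVecLin_apply] at h
    show (P 0 x).mulVec _ ∈ _
    exact Submodule.mem_sup_right (Submodule.mem_iSup_of_mem x h)

/-- THE FLAG LEMMA.  With invertible skeleton matrices the full span is reached with `j` free
positions for some `j` strictly below its dimension. -/
theorem exists_flag {v : Fin w → ℂ} (hv : v ≠ 0) :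
    ∀ (N : ℕ) (B : Fin N → Matrix (Fin w) (Fin w) ℂ) (P : Fin N → ℂ → Matrix (Fin w) (Fin w) ℂ),
      (∀ i, IsUnit (B i)) →
        ∃ j, j + 1 ≤ Module.finrank ℂ (gam B P v N) ∧ gam B P v N ≤ gam B P v j
  | 0, B, P, _ => by
    refine ⟨0, ?_, le_rfl⟩
    have hmem : v ∈ gam B P v 0 := by
      have h := mem_gam (B := B) (P := P) (v := v) (s := 0) (a := fun _ => none)
        (by simp [freeCount])
      rwa [selProd, List.ofFn_zero, List.prod_nil, Matrix.one_mulVec] at h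
    rw [zero_add, ← finrank_span_singleton (K := ℂ) hv]
    exact Submodule.finrank_mono ((Submodule.span_singleton_le_iff_mem v _).2 hmem)
  | N + 1, B, P, hB => by
    obtain ⟨j, hj, hle⟩ := exists_flag hv N (Fin.tail B) (Fin.tail P) fun i => hB i.succ
    have hinj : Function.Injective (B 0).mulVecLin := by
      rw [Matrix.coe_mulVecLin]
      exact Matrix.mulVec_injective_iff_isUnit.2 (hB 0)
    have hrank : Module.finrank ℂ ((gam (Fin.tail B) (Fin.tail P) v N).map (B 0).mulVecLin) =
        Module.finrank ℂ (gam (Fin.tail B) (Fin.tail P) v N) :=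
      (Submodule.equivMapOfInjective _ hinj _).finrank_eq.symm
    have h1 : (gam (Fin.tail B) (Fin.tail P) v N).map (B 0).mulVecLin ≤ gam B P v (N + 1) :=
      (map_skel_le B P v N).trans (gam_mono B P v N.le_succ)
    have h2 : ∀ x, (gam (Fin.tail B) (Fin.tail P) v N).map (P 0 x).mulVecLin ≤ gam B P v (N + 1) :=
      fun x => map_free_le B P v x N
    by_cases hc : (⨆ x : ℂ, (gam (Fin.tail B) (Fin.tail P) v N).map (P 0 x).mulVecLin) ≤
        (gam (Fin.tail B) (Fin.tail P) v N).map (B 0).mulVecLin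
    · have heq : gam B P v (N + 1) = (gam (Fin.tail B) (Fin.tail P) v N).map (B 0).mulVecLin :=
        le_antisymm ((gam_succ_le B P v).trans (sup_le le_rfl hc)) h1
      refine ⟨j, by rw [heq, hrank]; exact hj, ?_⟩
      rw [heq]
      exact (Submodule.map_mono hle).trans (map_skel_le B P v j)
    · have hlt : (gam (Fin.tail B) (Fin.tail P) v N).map (B 0).mulVecLin < gam B P v (N + 1) :=
        lt_of_le_of_ne h1 fun heq => hc (by rw [heq]; exact iSup_le h2)
      have hlt' := Submodule.finrank_lt_finrank_of_lt hlt
      refine ⟨j + 1, by omega, (gam_succ_le B P v).trans (sup_le ?_ (iSup_le fun x => ?_))⟩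
      · exact ((Submodule.map_mono hle).trans (map_skel_le B P v j)).trans
          (gam_mono B P v j.le_succ)
      · exact (Submodule.map_mono hle).trans (map_free_le B P v x j)

/-- THE `(w − 1)`-SELECTION PRINCIPLE.  A covector orthogonal to every selected vector with at
most `w − 1` free positions is orthogonal to every selected vector. -/
theorem dotProduct_selProd_eq_zero (B : Fin N → Matrix (Fin w) (Fin w) ℂ)
    (P : Fin N → ℂ → Matrix (Fin w) (Fin w) ℂ) (hB : ∀ i, IsUnit (B i)) (u v : Fin w → ℂ)
    (h : ∀ a : Fin N → Option ℂ, freeCount a ≤ w - 1 → u ⬝ᵥ (selProd B P a).mulVec v = 0)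
    (a : Fin N → Option ℂ) : u ⬝ᵥ (selProd B P a).mulVec v = 0 := by
  by_cases hv : v = 0
  · rw [hv, Matrix.mulVec_zero, dotProduct_zero]
  obtain ⟨j, hj, hle⟩ := exists_flag hv N B P hB
  have hw : Module.finrank ℂ (gam B P v N) ≤ w :=
    (Submodule.finrank_le _).trans (Module.finrank_fin_fun ℂ).le
  have hmem : (selProd B P a).mulVec v ∈ gam B P v (w - 1) :=
    gam_mono B P v (by omega) (hle (mem_gam (freeCount_le a)))
  refine Submodule.span_induction (p := fun x _ => u ⬝ᵥ x = 0) (fun x hx => ?_)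
    (dotProduct_zero u)
    (fun x y _ _ hx hy => show u ⬝ᵥ (x + y) = 0 by
      rw [dotProduct_add, show u ⬝ᵥ x = 0 from hx, show u ⬝ᵥ y = 0 from hy, add_zero])
    (fun c x _ hx => show u ⬝ᵥ (c • x) = 0 by
      rw [dotProduct_smul, show u ⬝ᵥ x = 0 from hx, smul_zero]) hmem
  obtain ⟨a', ha', rfl⟩ := hx
  exact h a' ha'

/-! ## 2. Chains of univariate polynomial matrices -/

variable {σ : Type*}

/-- The chain polynomial `uᵀ · P_1(z_{π 1}) ⋯ P_N(z_{π N}) · v` of univariate polynomial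
matrices read in the order `π`. [this file, data] -/
def chainPoly (π : Fin N → σ) (P : Fin N → Matrix (Fin w) (Fin w) ℂ[X]) (u v : Fin w → ℂ) :
    MvPolynomial σ ℂ :=
  (fun a => C (u a)) ⬝ᵥ
    ((List.ofFn fun i => (P i).map (Polynomial.aeval (X (π i)))).prod).mulVec fun b => C (v b)

/-- Evaluating the chain polynomial = the chain of evaluated links. -/
theorem eval_chainPoly (π : Fin N → σ) (P : Fin N → Matrix (Fin w) (Fin w) ℂ[X])
    (u v : Fin w → ℂ) (y : σ → ℂ) :
    eval y (chainPoly π P u v) =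
      u ⬝ᵥ ((List.ofFn fun i => (P i).map (Polynomial.eval (y (π i)))).prod).mulVec v := by
  have hP : ∀ i, ((P i).map (Polynomial.aeval (X (π i)))).map (eval y) =
      (P i).map (Polynomial.eval (y (π i))) := fun i => by
    rw [Matrix.map_map]
    refine congrArg _ (funext fun p => ?_)
    show (aeval y) (Polynomial.aeval (X (π i)) p) = _
    rw [← Polynomial.aeval_algHom_apply, aeval_X, Polynomial.coe_aeval_eq_eval]
  have hprod : ((List.ofFn fun i => (P i).map (Polynomial.aeval (X (π i)))).prod).map (eval y) =
      (List.ofFn fun i => (P i).map (Polynomial.eval (y (π i)))).prod := by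
    rw [← RingHom.mapMatrix_apply, map_list_prod, List.map_ofFn]
    exact congrArg (fun f => (List.ofFn f).prod)
      (funext fun i => (RingHom.mapMatrix_apply _ _).trans (hP i))
  simp only [chainPoly, dotProduct, map_sum, map_mul, eval_C, RingHom.map_mulVec, hprod,
    Function.comp_def]

/-- Evaluating a restriction = evaluating at the restricted point. -/
theorem eval_restrict [DecidableEq σ] (S : Finset σ) (t : ℂ) (y : σ → ℂ)
    (D : MvPolynomial σ ℂ) :
    eval y (aeval (fun b => if b ∈ S then X b else (C t : MvPolynomial σ ℂ)) D) =
      eval (fun b => if b ∈ S then y b else t) D := by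
  have h1 : (aeval y).comp (aeval fun b => if b ∈ S then X b else (C t : MvPolynomial σ ℂ)) =
      aeval fun b => if b ∈ S then y b else t := by
    rw [comp_aeval]
    refine congrArg _ (funext fun b => ?_)
    show (aeval y) (if b ∈ S then X b else C t) = (if b ∈ S then y b else t)
    by_cases h : b ∈ S
    · rw [if_pos h, if_pos h, aeval_X]
    · rw [if_neg h, if_neg h, aeval_C]
      exact Algebra.algebraMap_self_apply t
  show (aeval y) (aeval _ D) = aeval (fun b => if b ∈ S then y b else t) D
  rw [← AlgHom.comp_apply, h1]

/-- A selection is realised by a restriction with at most `freeCount a` free variables,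
evaluated at a point. -/
theorem exists_eval_restrict_eq [DecidableEq σ] (π : Fin N → σ) (hπ : Function.Injective π)
    (P : Fin N → Matrix (Fin w) (Fin w) ℂ[X]) (u v : Fin w → ℂ) (t : ℂ)
    (a : Fin N → Option ℂ) :
    ∃ S : Finset σ, S.card ≤ freeCount a ∧ ∃ y : σ → ℂ,
      eval y (aeval (fun b => if b ∈ S then X b else (C t : MvPolynomial σ ℂ)) (chainPoly π P u v)) =
        u ⬝ᵥ (selProd (fun i => (P i).map (Polynomial.eval t))
          (fun i s => (P i).map (Polynomial.eval s)) a).mulVec v := by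
  have hz := hπ.extend_apply (fun i => (a i).elim t id) (fun _ => t)
  have hmemS : ∀ i, π i ∈ (Finset.univ.filter fun i => (a i).isSome).image π ↔ (a i).isSome :=
    fun i => by
    rw [Finset.mem_image]
    constructor
    · rintro ⟨j, hj, hji⟩
      obtain rfl := hπ hji
      exact (Finset.mem_filter.1 hj).2
    · exact fun h => ⟨i, Finset.mem_filter.2 ⟨Finset.mem_univ _, h⟩, rfl⟩
  refine ⟨(Finset.univ.filter fun i => (a i).isSome).image π, Finset.card_image_le,
    Function.extend π (fun i => (a i).elim t id) fun _ => t, ?_⟩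
  rw [eval_restrict, eval_chainPoly, selProd]
  refine congrArg (fun f : Fin N → Matrix (Fin w) (Fin w) ℂ => u ⬝ᵥ ((List.ofFn f).prod).mulVec v)
    (funext fun i => ?_)
  rw [hz i]
  rcases ho : a i with _ | s
  · simp only [Option.elim, ite_self]
  · have hi : π i ∈ (Finset.univ.filter fun i => (a i).isSome).image π :=
      (hmemS i).2 (ho ▸ Option.isSome_some)
    simp only [Option.elim, if_pos hi, id_eq]

/-- ★ THE SKELETON-FLAG WITNESS THEOREM.  A chain of univariate polynomial matrices, all
nonsingular at `t`, read in an injective order, whose restrictions to at most `w − 1` free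
variables (the others frozen at `t`) all vanish, is the zero polynomial.  [generator-free
instrument · 0 S-currency · closes no item · singular links NOT claimed] -/
theorem chainPoly_eq_zero_of_restrict [DecidableEq σ] (π : Fin N → σ)
    (hπ : Function.Injective π) (P : Fin N → Matrix (Fin w) (Fin w) ℂ[X]) (u v : Fin w → ℂ)
    (t : ℂ) (hdet : ∀ i, ((P i).map (Polynomial.eval t)).det ≠ 0)
    (hres : ∀ S : Finset σ, S.card ≤ w - 1 →
      aeval (fun b => if b ∈ S then X b else (C t : MvPolynomial σ ℂ)) (chainPoly π P u v) = 0) :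
    chainPoly π P u v = 0 := by
  refine MvPolynomial.funext fun y => ?_
  rw [map_zero, eval_chainPoly]
  have hsmall : ∀ a : Fin N → Option ℂ, freeCount a ≤ w - 1 →
      u ⬝ᵥ (selProd (fun i => (P i).map (Polynomial.eval t))
        (fun i s => (P i).map (Polynomial.eval s)) a).mulVec v = 0 := by
    intro a ha
    obtain ⟨S, hS, z, hz⟩ := exists_eval_restrict_eq π hπ P u v t a
    rw [← hz, hres S (hS.trans ha), map_zero]
  have key := dotProduct_selProd_eq_zero (fun i => (P i).map (Polynomial.eval t))
    (fun i s => (P i).map (Polynomial.eval s))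
    (fun i => (Matrix.isUnit_iff_isUnit_det _).2 (isUnit_iff_ne_zero.2 (hdet i))) u v hsmall
    (fun i => some (y (π i)))
  simpa only [selProd, Option.elim] using key

end Summit.ValiantsHypothesis.ValiantsHypothesis.Theorems.DefinabilityGapSkeletonFlag

end
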